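import Summits.HodgeConjecture.CorCM.Census.CyclicCharacterEvenNearBlocks

/-!
# Cyclic characters, XXVI: THE EVEN ℤ/4-SYLOW LAW — `μ(G, c) = φ₂(G, c) = β(G, c) − 1` for `w ↠ ℤ/4`, EVEN kernel, `d = 1`

COR-CM (cell `pub-hodgecm2`), count-neutral kernel combinatorics by the binder seat b09 (gen 43; lane CYCLIC-CHARACTER FIBRE LAW, part XXVI), on parts XVI
(the arc-shift META theorem), XIX (`zeta_mem_of_rels`, `fib_mem_of_rel`, `shift_mem_of_zeta_mem`), XXIV, XXV, XXVIa and gen 38/39ʼs covering on a set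
(`BaseBlock.exists_joint_cover_on`, `toward_of_explicit`, `toward_all_of_on`) BY NAME.  Theorems only (no definition, no `decide`, no certificate, no named
fact, no `sorry`).  HONEST FRAMING: `HC_CM` is NOT proved, here or anywhere in the tree; nothing here is a period or a headline.

**THE LAW (`isLeast_card_gfaces_generate_of_two_even`, `…_card_block`).**  Let `G` be finite, `c` a central involution, `w : G ↠ ℤ/4` additive (`k = 2`) with
`w c ≠ 0`, the kernel `F_0` of EVEN size `2m ≥ 4` (any structure: cyclic, `ℤ/2 × ℤ/2`, `S₃`, …), and `d = 1`: every `g` with `w g` odd has `c ∈ ⟨g⟩`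
(`ℤ/4 ⋊ ℤ/4` with `c = y²`, `ℤ/4 × S₃` and `ℤ/4 × ℤ/6` with `c = (2, ·)` trivial, `Dic₃ × ℤ/2` with `c = (y², 0)`, …).  Then
**`μ(G, c) = φ₂(G, c) = β(G, c) − 1`**.

PROOF (the even certificate).  Choose `C ⊆ F_0` with `|C| = m`, `b ≠ b' ∈ C`, `u ≠ u' ∈ F_0 ∖ C`, the tie `X_C`.  The family: gen 38ʼs cover of every block of
potential `≥ 2` EXCEPT the block of `X_C` (`exists_joint_cover_on`), the explicit DOWNWARD face `gface X_C b b'` at the tie (so the block of `X_C` is covered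
too, and `X_C` is linearised toward `T_0`, part XXIV), the ASCENDING tie face `gface X_C u u'` (⟹ `R(C)`, part XXV) and the even three-across face
`gface X_C^{(b)} b u` (its second tie corner is down or up by part XXIV: ⟹ `R(C ∪ u)` hence `ζ_u`, or `ζ_b` outright, part XXV).  Then `ζ_s` for every bottom
`s` (kernel translation), the fibre sum and the top arc shift (part XIX), and part XVIʼs META closes: `|S₀| ≤ (β − 3 − 1) + 3 = β − 1 = φ₂` (three near blocks from two kernel
elements, part XXVIa) by the fibre law with `d = 1` (gen 41).  For `d = 0` the same family generates but has `φ₂ + 1` members (numerics `HOME/pub-hodgecm2-b09/lean-g43/py/evenwalk.py`): the free relation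
is row-dependent and left to the successor.

## References
* [Pohlmann1968] H. Pohlmann, Algebraic cycles on abelian varieties of complex multiplication type, Ann. of Math. 88 (1968), Thm 1.
* [Milne1999] J. S. Milne, Lefschetz motives and the Tate conjecture, Compositio Math. 117 (1999), Prop. 2.1, p. 54.
-/

namespace Summit.HodgeConjecture.CorCM.Census.CyclicCharacter

open Finset
open Summit.HodgeConjecture.CorCM.Prior.AllgGroup.RfwfAllgGroup
open Summit.HodgeConjecture.CorCM.Census.BlockParity
open Summit.HodgeConjecture.CorCM.Census.Coinvariant
open Summit.HodgeConjecture.CorCM.Census.TwistGeneration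
open Summit.HodgeConjecture.CorCM.Census.Nondegenerate
open Summit.HodgeConjecture.CorCM.Census.BaseBlock
open Summit.HodgeConjecture.CorCM.Census.Splitting

noncomputable section

variable {G : Type*} [Group G] [Fintype G] [DecidableEq G] {k : ℕ} {w : G → ZMod (2 ^ k)} {c : G}

/-! ## §1 `ζ` at every bottom point from the even certificate (any `k ≥ 2`) -/

/-- **THE EVEN EQUATOR MECHANISM** (any `k ≥ 2`).  `L = ℤ⟨pairs⟩ + ℤ[G]·S` with the toward property; `C ⊆ F_0` with `2|C| = |F_0|`; `b ∈ C` with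
`2 ≤ |C|`; `u ≠ u' ∈ F_0 ∖ C`; the tie `X_C` with the downward face `gface X_C b b'` (`b' ∈ C ∖ b`), the ascending face `gface X_C u u'` and the three-across
face `gface X_C^{(b)} b u` all in `L`.  Then `R(C) ∈ L` and `ζ_s = ε_s + η_s ∈ L` for EVERY bottom point `s`. [folklore] -/
theorem rel_and_zeta_of_evenCert (hw : ∀ P Q : G, w (P * Q) = w P + w Q) (hk : 1 ≤ k) (hk2 : 2 ≤ k) (hc2 : c * c = 1)
    (hcen : ∀ x : G, x * c = c * x) (hwc : w c ≠ 0) (h1 : ∃ g₁ : G, w g₁ = 1) (S : Finset (CMF G c →₀ ℤ))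
    (htw : ∀ Φ : CMF G c, 2 ≤ bpot c (arcType hw hk hc2 hwc 0) Φ → ∃ Q t t' : G,
      bpot c (arcType hw hk hc2 hwc 0) Φ = ddist (rt c Q (arcType hw hk hc2 hwc 0)) Φ ∧
        t ∈ (rt c Q (arcType hw hk hc2 hwc 0)).1 \ Φ.1 ∧ t' ∈ (rt c Q (arcType hw hk hc2 hwc 0)).1 \ Φ.1 ∧ t ≠ t' ∧
          gface c hc2 Φ t t' ∈ Submodule.span ℤ (pairSet c) ⊔ Submodule.span ℤ (translates c S))
    {C : Finset G} (hCF : C ⊆ univ.filter fun s : G => w s = 0) (hCm : 2 * C.card = (univ.filter fun s : G => w s = 0).card) (hC2 : 2 ≤ C.card)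
    {X : CMF G c} (hX : (arcType hw hk hc2 hwc 0).1 \ X.1 = C)
    {b b' u u' : G} (hb : b ∈ C) (hb' : b' ∈ C) (hbb' : b ≠ b') (hu : u ∈ (univ.filter fun s : G => w s = 0) \ C)
    (hu' : u' ∈ (univ.filter fun s : G => w s = 0) \ C) (huu' : u ≠ u')
    (hfown : gface c hc2 X b b' ∈ Submodule.span ℤ (pairSet c) ⊔ Submodule.span ℤ (translates c S))
    (hfasc : gface c hc2 X u u' ∈ Submodule.span ℤ (pairSet c) ⊔ Submodule.span ℤ (translates c S))
    (hf3 : gface c hc2 (oflipCM c hc2 b X) b u ∈ Submodule.span ℤ (pairSet c) ⊔ Submodule.span ℤ (translates c S)) :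
    Finsupp.single (arcType hw hk hc2 hwc 0) (1 : ℤ) - Finsupp.single (arcType hw hk hc2 hwc 1) 1 +
        (∑ s ∈ C, (Finsupp.single (oflipCM c hc2 s (arcType hw hk hc2 hwc 0)) (1 : ℤ) - Finsupp.single (arcType hw hk hc2 hwc 0) 1)) -
        (∑ s ∈ (univ.filter fun s => w s = 0) \ C,
          (Finsupp.single (oflipCM c hc2 s (arcType hw hk hc2 hwc 1)) (1 : ℤ) - Finsupp.single (arcType hw hk hc2 hwc 1) 1)) ∈
        Submodule.span ℤ (pairSet c) ⊔ Submodule.span ℤ (translates c S) ∧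
      ∀ s : G, w s = 0 →
        (Finsupp.single (oflipCM c hc2 s (arcType hw hk hc2 hwc 0)) (1 : ℤ) - Finsupp.single (arcType hw hk hc2 hwc 0) 1) +
          (Finsupp.single (oflipCM c hc2 s (arcType hw hk hc2 hwc 1)) (1 : ℤ) - Finsupp.single (arcType hw hk hc2 hwc 1) 1) ∈
            Submodule.span ℤ (pairSet c) ⊔ Submodule.span ℤ (translates c S) := by
  set L := Submodule.span ℤ (pairSet c) ⊔ Submodule.span ℤ (translates c S) with hL
  have hb0 : w b = 0 := (mem_filter.mp (hCF hb)).2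
  have hu0 : w u = 0 := (mem_filter.mp (mem_sdiff.mp hu).1).2
  have hu'0 : w u' = 0 := (mem_filter.mp (mem_sdiff.mp hu').1).2
  have huC : u ∉ C := (mem_sdiff.mp hu).2
  have hu'C : u' ∉ C := (mem_sdiff.mp hu').2
  have hbu : b ≠ u := fun h => huC (h ▸ hb)
  have hbT : b ∈ (arcType hw hk hc2 hwc 0).1 := (mem_arcType_zero_and_notMem_one hw hk hc2 hwc hb0).1
  have hbX : b ∉ X.1 := fun h => (mem_sdiff.mp (hX.symm ▸ hb : b ∈ (arcType hw hk hc2 hwc 0).1 \ X.1)).2 h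
  -- the three-across base `X' = X^{(b)}` with deviation `C ∖ b`, and `X'^{(b)} = X`
  have hX' : (arcType hw hk hc2 hwc 0).1 \ (oflipCM c hc2 b X).1 = C.erase b := by rw [dev_oflip c hc2 hbT hbX, hX]
  have hX'b : oflipCM c hc2 b (oflipCM c hc2 b X) = X := oflipCM_oflipCM_self c hc2 b X
  have hlarge : 2 * ((univ.filter fun s : G => w s = 0).card - C.card - 1) < (univ.filter fun s : G => w s = 0).card := by omega
  have hsmall : 2 * (C.card - 1) < (univ.filter fun s : G => w s = 0).card := by omega
  -- `X` is linearised DOWN by its explicit face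
  have h2X : 2 * ((arcType hw hk hc2 hwc 0).1 \ X.1).card = (univ.filter fun s : G => w s = 0).card := by rw [hX]; exact hCm
  have eX := single_sub_normalForm_mem_of_face hw hk hc2 hwc L htw 1 (Φ := X)
    (by rw [rt_one]; unfold ddist; rw [hX]; omega) (by rw [rt_one, hX]; exact hb) (by rw [rt_one, hX]; exact hb') hbb' hfown
  rw [rt_one] at eX
  -- `R(C)` from the ascending face
  have hR := rel_of_tieAscending hw hk hc2 hwc h1 L htw hX hCF hlarge hu0 hu'0 huC hu'C huu' hfasc eX
  refine ⟨hR, ?_⟩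
  -- the second tie `X'^{(u)}`, deviation `C ∖ b ∪ u`: down or up
  have hXu : (arcType hw hk hc2 hwc 0).1 \ (oflipCM c hc2 u (oflipCM c hc2 b X)).1 = insert u (C.erase b) :=
    sdiff_oflipCM_eq_insert hw hk hc2 hwc hX' hu0 (fun h => huC (mem_of_mem_erase h))
  have hCue : insert u (C.erase b) ⊆ univ.filter fun s : G => w s = 0 :=
    insert_subset (mem_sdiff.mp hu).1 ((erase_subset b C).trans hCF)
  have hcue : (insert u (C.erase b)).card = C.card := by
    rw [card_insert_of_notMem (fun h => huC (mem_of_mem_erase h))]; exact card_erase_add_one hb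
  have h2u : 2 * ((arcType hw hk hc2 hwc 0).1 \ (oflipCM c hc2 u (oflipCM c hc2 b X)).1).card = (univ.filter fun s : G => w s = 0).card := by
    rw [hXu, hcue]; exact hCm
  have hpotu := bpot_eq_of_tie hw hk hc2 hwc h2u
  obtain ⟨Q, s, s', hQ, hs, hs', hss', hfQ⟩ := htw (oflipCM c hc2 u (oflipCM c hc2 b X)) (by rw [hpotu, hXu, hcue]; exact hC2)
  have hQd : ddist (rt c Q (arcType hw hk hc2 hwc 0)) (oflipCM c hc2 u (oflipCM c hc2 b X)) =
      ((arcType hw hk hc2 hwc 0).1 \ (oflipCM c hc2 u (oflipCM c hc2 b X)).1).card := by rw [← hQ, hpotu]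
  have eU := single_sub_normalForm_mem_of_face hw hk hc2 hwc L htw Q (Φ := oflipCM c hc2 u (oflipCM c hc2 b X))
    (by rw [hQd]; omega) hs hs' hss' hfQ
  have eb : Finsupp.single (oflipCM c hc2 b (oflipCM c hc2 b X)) (1 : ℤ) - ((∑ s ∈ (arcType hw hk hc2 hwc 0).1 \ (oflipCM c hc2 b (oflipCM c hc2 b X)).1,
      (Finsupp.single (oflipCM c hc2 s (arcType hw hk hc2 hwc 0)) (1 : ℤ) - Finsupp.single (arcType hw hk hc2 hwc 0) 1)) +
        Finsupp.single (arcType hw hk hc2 hwc 0) 1) ∈ L := by rw [hX'b]; exact eX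
  -- one `ζ` from the three-across face, in either orientation of the second tie
  have hζ0 : ∃ s₀ : G, w s₀ = 0 ∧
      (Finsupp.single (oflipCM c hc2 s₀ (arcType hw hk hc2 hwc 0)) (1 : ℤ) - Finsupp.single (arcType hw hk hc2 hwc 0) 1) +
        (Finsupp.single (oflipCM c hc2 s₀ (arcType hw hk hc2 hwc 1)) (1 : ℤ) - Finsupp.single (arcType hw hk hc2 hwc 1) 1) ∈ L := by
    rcases rt_arcType_eq_zero_or_one_of_tie hw hk hk2 hc2 hwc h1 (hXu.symm ▸ hCue) h2u
        (by rw [hXu]; exact ⟨u, mem_insert_self u _⟩) hQd with hdown | hup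
    · rw [hdown] at eU
      have hR1 := rel_of_threeAcross_even hw hk hc2 hwc h1 L htw hb hX' hCF hsmall hlarge hu0 huC hf3 eb eU
      exact ⟨u, hu0, zeta_mem_of_rels hw hk hc2 hwc L hu hR hR1⟩
    · rw [hup] at eU
      exact ⟨b, hb0, zeta_mem_of_threeAcross_even_up hw hk hc2 hwc h1 L htw hb hX' hCF hsmall hlarge hu0 huC hf3 eb eU⟩
  obtain ⟨s₀, hs₀, hζs₀⟩ := hζ0
  intro s hs
  exact zeta_mem_of_zeta_mem hw hk hc2 hcen hwc S hs₀ hs hζs₀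

/-! ## §2 THE EVEN ℤ/4-SYLOW LAW -/

/-- **THE EVEN ℤ/4-SYLOW LAW: `μ(G, c) = φ₂(G, c)` and `φ₂(G, c) + 1 = β(G, c)`** for every finite `G` with a central involution `c` and an additive
`w : G ↠ ℤ/4` (`k = 2`), `w c ≠ 0`, whose kernel has EVEN size `2m ≥ 4`, and with `d = 1` (every `g` with `w g` odd has `c ∈ ⟨g⟩`).  The least number of rank-four face relations whose base changes generate the integer Hodge lattice modulo the pairs is EXACTLY
`β − 1`. [folklore] -/
theorem isLeast_card_gfaces_generate_of_two_even [Fintype (CMF G c)] (hw : ∀ P Q : G, w (P * Q) = w P + w Q) (hk : 1 ≤ k) (hk2 : k = 2)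
    (hc2 : c * c = 1) (hcen : ∀ x : G, x * c = c * x) (hwc : w c ≠ 0) (h1 : ∃ g₁ : G, w g₁ = 1)
    (hroots : ∀ g : G, ¬ 2 ∣ (w g).val → c ∈ Subgroup.zpowers g)
    {m : ℕ} (hm : 2 * m = (univ.filter fun s : G => w s = 0).card) (hm2 : 2 ≤ m) :
    IsLeast {n : ℕ | ∃ S : Finset (CMF G c →₀ ℤ), (↑S ⊆ gfaceSet G c hc2) ∧ S.card = n ∧
      hodgeSpan c hc2 ≤ Submodule.span ℤ (pairSet c) ⊔ Submodule.span ℤ (translates c S)} (fibreTwo c hc2) ∧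
    fibreTwo c hc2 + 1 = Fintype.card (Block c) := by
  have hk' : 2 ≤ k := by omega
  have hβ := fibreTwo_add_one_eq_card_block hw hk' h1 hc2 hcen hwc hroots
  refine ⟨?_, hβ⟩
  -- `C ⊆ F_0` of size `m`, `b ≠ b' ∈ C`, `u ≠ u' ∈ F_0 ∖ C`
  obtain ⟨C, hCF, hCc⟩ := exists_subset_card_eq (s := (univ.filter fun s : G => w s = 0)) (n := m) (by omega)
  obtain ⟨b, hb, b', hb', hbb'⟩ := one_lt_card.mp (by omega : 1 < C.card)
  have hUc : ((univ.filter fun s : G => w s = 0) \ C).card = m := by have := card_sdiff_add_card_eq_card hCF; omega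
  obtain ⟨u, hu, u', hu', huu'⟩ := one_lt_card.mp (by omega : 1 < ((univ.filter fun s : G => w s = 0) \ C).card)
  have hb0 : w b = 0 := (mem_filter.mp (hCF hb)).2
  have hb'0 : w b' = 0 := (mem_filter.mp (hCF hb')).2
  have hu0 : w u = 0 := (mem_filter.mp (mem_sdiff.mp hu).1).2
  have hu'0 : w u' = 0 := (mem_filter.mp (mem_sdiff.mp hu').1).2
  have huC : u ∉ C := (mem_sdiff.mp hu).2
  have hbu : b ≠ u := fun h => huC (h ▸ hb)
  have hwc' : ∀ x : G, w x = 0 → ∀ y : G, w y = 0 → y ≠ c * x := by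
    intro x hx y hy h
    apply hwc
    have := congrArg w h
    rw [hw, hx, hy, add_zero] at this
    exact this.symm
  -- the tie `X_C`, the three faces
  obtain ⟨X, hX⟩ := exists_sdiff_eq_of_subset_fibre hw hk hc2 hwc C hCF
  have hfown : gface c hc2 X b b' ∈ gfaceSet G c hc2 :=
    ⟨X, b, b', by rw [mem_orb]; push Not; exact ⟨hbb'.symm, hwc' b hb0 b' hb'0⟩, rfl⟩
  have hfasc : gface c hc2 X u u' ∈ gfaceSet G c hc2 :=
    ⟨X, u, u', by rw [mem_orb]; push Not; exact ⟨huu'.symm, hwc' u hu0 u' hu'0⟩, rfl⟩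
  have hf3 : gface c hc2 (oflipCM c hc2 b X) b u ∈ gfaceSet G c hc2 :=
    ⟨oflipCM c hc2 b X, b, u, by rw [mem_orb]; push Not; exact ⟨hbu.symm, hwc' b hb0 u hu0⟩, rfl⟩
  -- the tie has potential `m ≥ 2`
  have h2X : 2 * ((arcType hw hk hc2 hwc 0).1 \ X.1).card = (univ.filter fun s : G => w s = 0).card := by rw [hX, hCc]; exact hm
  have hpotX : bpot c (arcType hw hk hc2 hwc 0) X = m := by rw [bpot_eq_of_tie hw hk hc2 hwc h2X, hX, hCc]
  -- gen 38ʼs cover of the far blocks OTHER than the block of the tie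
  obtain ⟨Sc, hScf, hScc, -, -, -, htwc⟩ := exists_joint_cover_on c (arcType hw hk hc2 hwc 0) hc2
    (fun Bk : Block c => 2 ≤ bpot c (arcType hw hk hc2 hwc 0) Bk.out ∧ Bk ≠ blk c X) (fun _ h => h.1) ∅
    (by rw [Finset.coe_empty]; exact linearIndepOn_empty _ _) (fun f hf => absurd hf (Finset.notMem_empty f))
  set S₀ : Finset (CMF G c →₀ ℤ) := Sc ∪ {gface c hc2 X b b', gface c hc2 X u u', gface c hc2 (oflipCM c hc2 b X) b u} with hS₀
  have hS₀f : (↑S₀ : Set (CMF G c →₀ ℤ)) ⊆ gfaceSet G c hc2 := by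
    intro f hf
    rw [hS₀, coe_union, Set.mem_union] at hf
    rcases hf with hf | hf
    · exact hScf hf
    · simp only [coe_insert, coe_singleton, Set.mem_insert_iff, Set.mem_singleton_iff] at hf
      rcases hf with rfl | rfl | rfl
      · exact hfown
      · exact hfasc
      · exact hf3
  have hScS : Sc ⊆ S₀ := subset_union_left
  have hmemS : ∀ f ∈ ({gface c hc2 X b b', gface c hc2 X u u', gface c hc2 (oflipCM c hc2 b X) b u} : Finset (CMF G c →₀ ℤ)), f ∈ S₀ :=
    fun f hf => by rw [hS₀]; exact mem_union_right _ hf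
  have hownS : gface c hc2 X b b' ∈ S₀ := hmemS _ (mem_insert_self _ _)
  have hascS : gface c hc2 X u u' ∈ S₀ := hmemS _ (mem_insert_of_mem (mem_insert_self _ _))
  have h3S : gface c hc2 (oflipCM c hc2 b X) b u ∈ S₀ := hmemS _ (mem_insert_of_mem (mem_insert_of_mem (mem_singleton_self _)))
  -- the toward property: the cover on the far blocks, the explicit downward face on the block of the tie
  have htw : ∀ Φ : CMF G c, 2 ≤ bpot c (arcType hw hk hc2 hwc 0) Φ → ∃ Q s s' : G, bpot c (arcType hw hk hc2 hwc 0) Φ = ddist (rt c Q (arcType hw hk hc2 hwc 0)) Φ ∧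
      s ∈ (rt c Q (arcType hw hk hc2 hwc 0)).1 \ Φ.1 ∧ s' ∈ (rt c Q (arcType hw hk hc2 hwc 0)).1 \ Φ.1 ∧ s ≠ s' ∧
        gface c hc2 Φ s s' ∈ Submodule.span ℤ (pairSet c) ⊔ Submodule.span ℤ (translates c S₀) := by
    have hsub : Submodule.span ℤ (translates c Sc) ≤ Submodule.span ℤ (pairSet c) ⊔ Submodule.span ℤ (translates c S₀) :=
      (Submodule.span_mono fun y hy => by obtain ⟨Q, f, hf, e⟩ := hy; exact ⟨Q, f, hScS hf, e⟩).trans le_sup_right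
    refine toward_all_of_on c (arcType hw hk hc2 hwc 0) hc2 (fun Bk : Block c => 2 ≤ bpot c (arcType hw hk hc2 hwc 0) Bk.out ∧ Bk ≠ blk c X) _ ?_ ?_
    · intro Φ hΦ
      exact htwc _ hsub Φ hΦ
    · intro Φ hΦ hnot
      have hblk : blk c Φ = blk c X := by
        by_contra h
        exact hnot ⟨by rw [bpot_out]; exact hΦ, h⟩
      refine toward_of_explicit c (arcType hw hk hc2 hwc 0) hc2 _ (Q₀ := 1) (t := b) (t' := b')
        (by rw [rt_one, bpot_eq_of_tie hw hk hc2 hwc h2X]; rfl) (by rw [rt_one, hX]; exact hb) (by rw [rt_one, hX]; exact hb') hbb' ?_ hblk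
      intro Q
      exact Submodule.mem_sup_right (Submodule.subset_span ⟨Q, _, hownS, rfl⟩)
  have hcov := fun Φ => hcov_of_toward c (arcType hw hk hc2 hwc 0) hc2 S₀ htw Φ
  -- the three faces lie in `L`
  have hL := fun f (hf : f ∈ S₀) => (Submodule.mem_sup_right (mem_span_translates_of_mem c S₀ hf) :
    f ∈ Submodule.span ℤ (pairSet c) ⊔ Submodule.span ℤ (translates c S₀))
  -- `R(C)` and every `ζ_s`
  obtain ⟨hR, hζ⟩ := rel_and_zeta_of_evenCert hw hk hk' hc2 hcen hwc h1 S₀ htw hCF (by rw [hCc]; exact hm) (by omega) hX hb hb' hbb' hu hu' huu'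
    (hL _ hownS) (hL _ hascS) (hL _ h3S)
  have hfib := fib_mem_of_rel hw hk hc2 hwc _ hCF hR fun s hs => hζ s (mem_filter.mp (mem_sdiff.mp hs).1).2
  have hshift : ∀ s ∈ ((arcType hw hk hc2 hwc 0)).1,
      Finsupp.single (oflipCM c hc2 s (arcType hw hk hc2 hwc 0)) (1 : ℤ) - Finsupp.single (arcType hw hk hc2 hwc 0) 1 -
        Finsupp.single (oflipCM c hc2 s (arcType hw hk hc2 hwc (w s))) 1 + Finsupp.single (arcType hw hk hc2 hwc (w s)) 1 ∈
          Submodule.span ℤ (pairSet c) ⊔ Submodule.span ℤ (translates c S₀) := by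
    intro s hs
    rcases apply_eq_zero_or_eq_top_of_two hw hk hk2 hc2 hwc hs with h | h
    · rw [shift_eq_zero_of_apply_eq_zero hw hk hc2 hwc h]; exact Submodule.zero_mem _
    · have h' : w s = 1 := by rw [h]; subst hk2; decide
      exact shift_mem_of_zeta_mem hw hk hk2 hc2 hcen hwc S₀ hb0 h' (hζ b hb0)
  -- the count: `|S₀| ≤ (β − 3 − 1) + 3 = φ₂`
  obtain ⟨n₀, n₁, hn₀1, hn₁1, hn₀₁, hn₀, hn₁⟩ := exists_two_ker hw (by omega)
  have hnear := half_add_one_le_card_filter_bpot_le_one' hw hk hc2 hcen hwc h1 hn₀1 hn₁1 hn₀₁ hn₀ hn₁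
  have hpk : 2 ^ (k - 1) + 1 = 3 := by rw [hk2]; norm_num
  rw [hpk] at hnear
  have hsplit := card_filter_add_card_filter_not (s := (univ : Finset (Block c))) (fun Bk : Block c => 2 ≤ bpot c (arcType hw hk hc2 hwc 0) Bk.out)
  have hneg : (univ.filter fun Bk : Block c => ¬ 2 ≤ bpot c (arcType hw hk hc2 hwc 0) Bk.out) = univ.filter fun Bk : Block c => bpot c (arcType hw hk hc2 hwc 0) Bk.out ≤ 1 :=
    filter_congr fun Bk _ => by omega
  rw [hneg, card_univ] at hsplit
  have hfar : (univ.filter fun Bk : Block c => 2 ≤ bpot c (arcType hw hk hc2 hwc 0) Bk.out ∧ Bk ≠ blk c X) =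
      (univ.filter fun Bk : Block c => 2 ≤ bpot c (arcType hw hk hc2 hwc 0) Bk.out).erase (blk c X) := by
    ext Bk
    simp only [mem_filter, mem_univ, true_and, mem_erase]
    tauto
  have hXfar : blk c X ∈ univ.filter fun Bk : Block c => 2 ≤ bpot c (arcType hw hk hc2 hwc 0) Bk.out := by
    rw [mem_filter, bpot_out, hpotX]; exact ⟨mem_univ _, hm2⟩
  have hfarc := card_erase_add_one hXfar
  rw [← hfar] at hfarc
  have hcard : S₀.card ≤ fibreTwo c hc2 := by
    have h3 : ({gface c hc2 X b b', gface c hc2 X u u', gface c hc2 (oflipCM c hc2 b X) b u} : Finset (CMF G c →₀ ℤ)).card ≤ 3 :=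
      (card_insert_le _ _).trans (by have := card_insert_le (gface c hc2 X u u') ({gface c hc2 (oflipCM c hc2 b X) b u} : Finset (CMF G c →₀ ℤ)); rw [card_singleton] at this; omega)
    have hun := card_union_le Sc ({gface c hc2 X b b', gface c hc2 X u u', gface c hc2 (oflipCM c hc2 b X) b u} : Finset (CMF G c →₀ ℤ))
    rw [← hS₀, hScc] at hun
    omega
  exact (isLeast_card_gfaces_generate_of_shift hw hk hc2 hcen hwc h1 S₀ hS₀f hcard hcov hshift hfib).2

/-- **THE EVEN ℤ/4-SYLOW LAW, block form: `μ(G, c) = β(G, c) − 1`.** [folklore] -/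
theorem isLeast_card_gfaces_generate_of_two_even_card_block [Fintype (CMF G c)] (hw : ∀ P Q : G, w (P * Q) = w P + w Q) (hk : 1 ≤ k)
    (hk2 : k = 2) (hc2 : c * c = 1) (hcen : ∀ x : G, x * c = c * x) (hwc : w c ≠ 0) (h1 : ∃ g₁ : G, w g₁ = 1)
    (hroots : ∀ g : G, ¬ 2 ∣ (w g).val → c ∈ Subgroup.zpowers g)
    {m : ℕ} (hm : 2 * m = (univ.filter fun s : G => w s = 0).card) (hm2 : 2 ≤ m) :
    IsLeast {n : ℕ | ∃ S : Finset (CMF G c →₀ ℤ), (↑S ⊆ gfaceSet G c hc2) ∧ S.card = n ∧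
      hodgeSpan c hc2 ≤ Submodule.span ℤ (pairSet c) ⊔ Submodule.span ℤ (translates c S)} (Fintype.card (Block c) - 1) := by
  obtain ⟨h, hβ⟩ := isLeast_card_gfaces_generate_of_two_even hw hk hk2 hc2 hcen hwc h1 hroots hm hm2
  rw [← hβ, Nat.add_sub_cancel]
  exact h

end

end Summit.HodgeConjecture.CorCM.Census.CyclicCharacter
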